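import Mathlib
import Literature.Analysis.FluidPDE.VectorCalculus
import Summits.NavierStokesRegularity.NavierStokesRegularity.Theorems.FilamentSkeletonRssClause13RAdjointNonlocalBounded
import Summits.NavierStokesRegularity.NavierStokesRegularity.Theorems.FilamentSkeletonRssClause13RAdjointWaistIntegrable

/-!
# Clause 13-R, STUB R at MODEL level: NO bounded annihilating density ACROSS the waist — the improper energy identity on the
# punctured ball (census item (R-m1) of hand fsrs-19-g0; crux `Clause13RNearStraightL`, stmt-NavierStokesRegularity-23612; line
# `rate_bordered_split`, STUB R `stub_rateRow13RFlat`)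

Route `FilamentSkeletonRss`, Variant A1R.  The MODEL adjoint equation of STUB R (one straight axis, constant core; currency of
`…Clause13RAdjointStraightModelWeights`) on the tangency ball `S = [a, b]` is
  `cst • (m σ • (φ σ × d) − ∫_{τ∈S} k(τ−σ) • (φ τ × d) dτ) + ½ φ σ + α e × φ σ + w′(σ) φ σ + w(σ) φ′(σ) = 0`,
with an even continuous kernel `k` and a `C¹` slip `w` vanishing at the waist station `c ∈ (a, b)` (`w(a) ≤ 0 ≤ w(b)`, `w′ > −1`).
On the tree: every `C¹` solution on `S` vanishes (energy identity, `…Clause13RAdjointEnergy` p828845); so does every solution that is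
`C¹` on each CLOSED half-ball (`…Clause13RAdjointPiecewise` p830801); and locally at the waist an `L¹` solution on a PUNCTURED half-ball is
the bounded waist-regular branch (`…Clause13RAdjointWaistIntegrable` p831266 over `…WaistSourced(Left)` p831138/p831220).  THE JUNCTION WAS
MISSING (exit report of hand fsrs-19-g0, item (R-m1)): a solution only known to be differentiable on the PUNCTURED ball `S ∖ {c}` and
bounded — the a-priori regularity of the density part of an annihilating measure — with NOTHING assumed at `c`.  THIS FILE CLOSES IT:
`model_adjoint_no_bounded_punctured_annihilator` — `a < c < b`, `w(c) = 0`, `w(a) ≤ 0 ≤ w(b)`, `w′ ≥ −1 + 2ε`; every solution of the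
homogeneous equation on `S ∖ {c}`, differentiable on `S ∖ {c}` and BOUNDED on `S`, vanishes on `S ∖ {c}`; and
`model_adjoint_no_integrable_punctured_annihilator` — «bounded» replaced by «INTEGRABLE on `S`» under the two-sided linear opening of the
slip at the waist `κ₁|s − c| ≤ |w(s)| ≤ κ₂|s − c|` (`κ₁ > 0`), by the landed `L¹ ⟹ waist-regular` classification (p831266).
Mechanism (improper energy identity WITHOUT an `η`-limit): the flux `P(σ) = w(σ)‖φ(σ)‖²` has `P(c) = 0` whatever `φ(c)` is and is
continuous at `c` from both sides once `φ` is bounded (`w → 0`); off `c` it is differentiable with `P′ = w′‖φ‖² + 2w⟪φ′, φ⟫ =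
2cst⟪Nφ, φ⟫ − (1 + w′)‖φ‖²` (pair the equation with `φ`; self-induction and swirl terms are pointwise orthogonal to `φ`), integrable on
`S`.  FTC on `[a, c]` and `[c, b]` SEPARATELY gives `0 ≤ w(b)‖φ(b)‖² − w(a)‖φ(a)‖² = ∫_S P′ = 2cst·0 − ∫_S (1 + w′)‖φ‖²`, the nonlocal
pairing vanishing by antisymmetry + Fubini for a bounded a.e.-measurable weight (`setIntegral_inner_nonlocal_eq_zero_of_bounded`, the
`L^∞` twin of p828845's continuous version); hence `∫_S ‖φ‖² ≤ 0` and `φ = 0` on each punctured half by continuity.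
Planner-facing meaning (memo DIAG-23612-R-currency-leafhand19-g0.md §3 (F1)): at model level the density part of an annihilating measure
of the linearised operator on clamped fields carries no information beyond the edge data — `C¹` (p828845), piecewise-`C¹` (p830801) and
now bounded / `L¹` punctured densities all vanish for the homogeneous equation; the cokernel met by the rate row is the EDGE family.  [folklore]
Hand `leafhand-ns-filamentskeletonrs-19-g1` (LAND-ONLY); `--supports stmt-NavierStokesRegularity-23612` helper, def-free.  HONEST FRAMING:
bookkeeping for the MODEL adjoint equation attached to a HYPOTHETICAL filament skeleton on the NEGATIVE side of a MODEL blow-up route;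
STUB R is NOT proved here and nothing in this file bears on Navier–Stokes regularity or blow-up.
-/


noncomputable section

open MeasureTheory Filter Topology Set intervalIntegral
open scoped RealInnerProductSpace InnerProductSpace
open Literature.Analysis.FluidPDE
open Summit.NavierStokesRegularity.NavierStokesRegularity.Theorems.Clause13RAdjointEnergy (inner_cross_left_swap)
open Summit.NavierStokesRegularity.NavierStokesRegularity.Theorems.Clause13RAdjointNonlocalBounded
open Summit.NavierStokesRegularity.NavierStokesRegularity.Theorems.Clause13RAdjointWaistIntegrable
  (wnorm_le_of_integrableOn_right wnorm_le_of_integrableOn_left)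

namespace Summit.NavierStokesRegularity.NavierStokesRegularity.Theorems.Clause13RAdjointPunctured
set_option linter.dupNamespace false

/-! ## §1 Integrability bookkeeping on the ball -/

/-- A function a.e.-measurable and bounded on `[a, b]` is integrable there. [folklore] -/
theorem integrableOn_Icc_of_bounded {a b C : ℝ} {f : ℝ → ℝ} (hfm : AEStronglyMeasurable f (volume.restrict (Icc a b)))
    (hC : ∀ σ ∈ Icc a b, |f σ| ≤ C) : IntegrableOn f (Icc a b) :=
  Integrable.mono' (integrable_const C) hfm (by
    filter_upwards [ae_restrict_mem measurableSet_Icc] with σ hσ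
    rw [Real.norm_eq_abs]
    exact hC σ hσ)

/-- … and interval-integrable on every sub-interval. [folklore] -/
theorem intervalIntegrable_of_integrableOn_Icc {a b a' b' : ℝ} {f : ℝ → ℝ} (h : IntegrableOn f (Icc a b))
    (ha : a ≤ a') (hab' : a' ≤ b') (hb : b' ≤ b) : IntervalIntegrable f volume a' b' :=
  (h.mono_set (by rw [uIcc_of_le hab']; exact Icc_subset_Icc ha hb)).intervalIntegrable

/-- If `∫_a^b ‖φ‖² ≤ 0` and `φ` is continuous on a non-degenerate sub-interval `[a', b']`, then `φ = 0` there. [folklore] -/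
theorem eq_zero_of_integral_norm_sq_le {a b a' b' σ₀ : ℝ} {φ : ℝ → EuclideanSpace ℝ (Fin 3)} (ha : a ≤ a') (hlt : a' < b')
    (hb : b' ≤ b) (hcont : ContinuousOn φ (Icc a' b')) (hI : IntervalIntegrable (fun σ => ‖φ σ‖ ^ 2) volume a b)
    (hle : ∫ σ in a..b, ‖φ σ‖ ^ 2 ≤ 0) (hσ₀ : σ₀ ∈ Icc a' b') : φ σ₀ = 0 := by
  by_contra hne
  have hpos : 0 < ‖φ σ₀‖ ^ 2 := by positivity
  have hlt_int : (∫ σ in a'..b', (fun _ => (0 : ℝ)) σ) < ∫ σ in a'..b', ‖φ σ‖ ^ 2 :=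
    intervalIntegral.integral_lt_integral_of_continuousOn_of_le_of_exists_lt hlt continuousOn_const (hcont.norm.pow 2)
      (fun σ _ => sq_nonneg _) ⟨σ₀, hσ₀, hpos⟩
  simp only [intervalIntegral.integral_zero] at hlt_int
  have hmono : ∫ σ in a'..b', ‖φ σ‖ ^ 2 ≤ ∫ σ in a..b, ‖φ σ‖ ^ 2 :=
    intervalIntegral.integral_mono_interval ha hlt.le hb (Eventually.of_forall fun σ => sq_nonneg _) hI
  linarith

/-! ## §2 The flux `P = w‖φ‖²`: continuity across the waist, derivative off the waist -/

/-- **The flux is continuous on any sub-ball**, including AT the waist station: `P(c) = w(c)‖φ(c)‖² = 0` whatever `φ(c)` is, and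
`|P(σ)| ≤ |w(σ)| M² → 0` as `σ → c` for a bounded weight. [folklore] -/
theorem continuousOn_flux {a b a' b' c M : ℝ} {w : ℝ → ℝ} {φ φ' : ℝ → EuclideanSpace ℝ (Fin 3)}
    (hwc : Continuous w) (hwc0 : w c = 0) (hsub : Icc a' b' ⊆ Icc a b)
    (hφ : ∀ σ ∈ Icc a b, σ ≠ c → HasDerivAt φ (φ' σ) σ) (hbdd : ∀ σ ∈ Icc a b, ‖φ σ‖ ≤ M) :
    ContinuousOn (fun σ => w σ * ‖φ σ‖ ^ 2) (Icc a' b') := by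
  intro σ₀ hσ₀
  by_cases h0 : σ₀ = c
  · subst h0
    have hP0 : w σ₀ * ‖φ σ₀‖ ^ 2 = 0 := by rw [hwc0, zero_mul]
    show ContinuousWithinAt (fun σ => w σ * ‖φ σ‖ ^ 2) (Icc a' b') σ₀
    rw [ContinuousWithinAt, hP0]
    refine squeeze_zero_norm' (a := fun σ => |w σ| * M ^ 2) ?_ ?_
    · filter_upwards [self_mem_nhdsWithin] with σ hσ
      rw [norm_mul, Real.norm_eq_abs, norm_pow, norm_norm]
      exact mul_le_mul_of_nonneg_left (pow_le_pow_left₀ (norm_nonneg _) (hbdd σ (hsub hσ)) 2) (abs_nonneg _)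
    · have : Tendsto (fun σ => |w σ| * M ^ 2) (𝓝[Icc a' b'] σ₀) (𝓝 (|w σ₀| * M ^ 2)) :=
        ((hwc.continuousAt.continuousWithinAt).tendsto.abs).mul_const _
      rwa [hwc0, abs_zero, zero_mul] at this
  · exact ((hwc.continuousAt).mul (((hφ σ₀ (hsub hσ₀) h0).continuousAt.norm).pow 2)).continuousWithinAt

/-- Off the waist the flux is differentiable: `P′ = w′‖φ‖² + 2w⟪φ′, φ⟫`. [folklore] -/
theorem hasDerivAt_flux {w w' : ℝ → ℝ} {φ φ' : ℝ → EuclideanSpace ℝ (Fin 3)} {σ : ℝ}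
    (hw : HasDerivAt w (w' σ) σ) (hφ : HasDerivAt φ (φ' σ) σ) :
    HasDerivAt (fun x => w x * ‖φ x‖ ^ 2) (w' σ * ‖φ σ‖ ^ 2 + 2 * w σ * ⟪φ' σ, φ σ⟫) σ := by
  have h := hw.mul hφ.norm_sq
  have : w' σ * ‖φ σ‖ ^ 2 + 2 * w σ * ⟪φ' σ, φ σ⟫ = w' σ * ‖φ σ‖ ^ 2 + w σ * (2 * ⟪φ σ, φ' σ⟫) := by
    rw [real_inner_comm]; ring
  rw [this]
  exact h

/-- **Pairing the equation with `φ`** (pointwise, off the waist): the flux derivative equals `2cst⟪N, φ⟫ − (1 + w′)‖φ‖²`. [folklore] -/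
theorem flux_deriv_eq {cst α : ℝ} {m w w' : ℝ → ℝ} {φ φ' : ℝ → EuclideanSpace ℝ (Fin 3)} {d e : EuclideanSpace ℝ (Fin 3)}
    {N : ℝ → EuclideanSpace ℝ (Fin 3)} {σ : ℝ}
    (heq : cst • (m σ • cross (φ σ) d - N σ) + (1 / 2 : ℝ) • φ σ + α • cross e (φ σ) + w' σ • φ σ + w σ • φ' σ = 0) :
    w' σ * ‖φ σ‖ ^ 2 + 2 * w σ * ⟪φ' σ, φ σ⟫ = 2 * cst * ⟪N σ, φ σ⟫ - (1 + w' σ) * ‖φ σ‖ ^ 2 := by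
  -- the orthogonalities `⟪x × d, x⟫ = 0 = ⟪e × x, x⟫` (landed as `DepletionLadder.inner_cross_curl_left/_self`; re-derived inline)
  have hx0 : ⟪cross (φ σ) d, φ σ⟫ = 0 := by
    have h := inner_cross_left_swap (φ σ) (φ σ) d
    linarith
  have he0 : ⟪cross e (φ σ), φ σ⟫ = 0 := by
    simp only [cross, cross_apply, PiLp.inner_apply, RCLike.inner_apply, conj_trivial, Fin.sum_univ_three,
      Matrix.cons_val_zero, Matrix.cons_val_one, Matrix.cons_val_two, Matrix.head_cons, Matrix.tail_cons]
    ring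
  have h := congrArg (fun v => ⟪v, φ σ⟫) heq
  simp only [inner_add_left, inner_sub_left, inner_smul_left, conj_trivial, hx0, he0,
    real_inner_self_eq_norm_sq, inner_zero_left, mul_zero] at h
  linarith

/-! ## §3 THE JUNCTION: no bounded punctured annihilator -/

/-- **NO BOUNDED ANNIHILATING DENSITY ACROSS THE WAIST (model adjoint equation, punctured ball).**  On `S = [a, b]` with
`a < c < b`, let the slip `w ∈ C¹(ℝ)` satisfy `w(c) = 0`, `w(a) ≤ 0 ≤ w(b)` and `w′ ≥ −1 + 2ε` on `S` (`ε > 0`); let `k` be a continuous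
even kernel, `m` any scalar weight, `cst, α` constants, `d, e` vectors.  If `φ` is differentiable at every point of `S ∖ {c}` (nothing
assumed at `c`), BOUNDED on `S`, and solves the homogeneous equation
`cst • (m σ • (φ σ × d) − ∫_{τ∈S} k(τ−σ) • (φ τ × d) dτ) + ½ φ σ + α e × φ σ + w′ σ φ σ + w σ φ′ σ = 0` at every `σ ∈ S ∖ {c}`,
then `φ = 0` on `S ∖ {c}`.  Proof: FTC for the flux `w‖φ‖²` on `[a, c]` and `[c, b]` separately + the vanishing nonlocal pairing. [folklore] -/
theorem model_adjoint_no_bounded_punctured_annihilator {a b c cst α ε M : ℝ} (hac : a < c) (hcb : c < b) (hε : 0 < ε)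
    {k m w w' : ℝ → ℝ} {φ φ' : ℝ → EuclideanSpace ℝ (Fin 3)} {d e : EuclideanSpace ℝ (Fin 3)}
    (hk : Continuous k) (hkev : ∀ s, k (-s) = k s)
    (hw : ∀ σ, HasDerivAt w (w' σ) σ) (hw'c : Continuous w') (hwc0 : w c = 0)
    (hwa : w a ≤ 0) (hwb : 0 ≤ w b) (hgrowth : ∀ σ ∈ Icc a b, -1 + 2 * ε ≤ w' σ)
    (hφ : ∀ σ ∈ Icc a b, σ ≠ c → HasDerivAt φ (φ' σ) σ) (hbdd : ∀ σ ∈ Icc a b, ‖φ σ‖ ≤ M)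
    (heq : ∀ σ ∈ Icc a b, σ ≠ c →
      cst • (m σ • cross (φ σ) d - ∫ τ in Icc a b, k (τ - σ) • cross (φ τ) d)
        + (1 / 2 : ℝ) • φ σ + α • cross e (φ σ) + w' σ • φ σ + w σ • φ' σ = 0) :
    ∀ σ ∈ Icc a b, σ ≠ c → φ σ = 0 := by
  have hab : a ≤ b := (hac.trans hcb).le
  have hwc : Continuous w := continuous_iff_continuousAt.2 fun σ => (hw σ).continuousAt
  have hφm : AEStronglyMeasurable φ (volume.restrict (Icc a b)) := aestronglyMeasurable_of_hasDerivAt_off hφ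
  -- the nonlocal term `N`
  set N : ℝ → EuclideanSpace ℝ (Fin 3) := fun σ => ∫ τ in Icc a b, k (τ - σ) • cross (φ τ) d with hN
  obtain ⟨K, hK0, hK⟩ := kernel_bound_on_ball (a := a) (b := b) hk
  have hNm : AEStronglyMeasurable N (volume.restrict (Icc a b)) := aestronglyMeasurable_nonlocal hk hφm d
  set G : ℝ := K * (M * ‖d‖) * volume.real (Icc a b) with hG
  have hNb : ∀ σ ∈ Icc a b, ‖N σ‖ ≤ G := fun σ hσ => norm_nonlocal_le_of_bounded hK hK0 hbdd d hσ
  have hG0 : 0 ≤ G := (norm_nonneg _).trans (hNb a ⟨le_rfl, hab⟩)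
  -- a bound for `w'` on the ball
  obtain ⟨W, hW⟩ := (isCompact_Icc (a := a) (b := b)).exists_bound_of_continuousOn hw'c.continuousOn
  -- the two forms of the flux derivative
  set p : ℝ → ℝ := fun σ => w' σ * ‖φ σ‖ ^ 2 + 2 * w σ * ⟪φ' σ, φ σ⟫ with hp
  set q : ℝ → ℝ := fun σ => 2 * cst * ⟪N σ, φ σ⟫ - (1 + w' σ) * ‖φ σ‖ ^ 2 with hq
  have hpq : ∀ σ ∈ Icc a b, σ ≠ c → p σ = q σ := fun σ hσ hσc => flux_deriv_eq (heq σ hσ hσc)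
  -- the three bounded integrands `2cst⟪N, φ⟫`, `(1 + w')‖φ‖²`, `‖φ‖²` are integrable on the ball
  have hNS : IntegrableOn (fun σ => 2 * cst * ⟪N σ, φ σ⟫) (Icc a b) := by
    refine integrableOn_Icc_of_bounded (aestronglyMeasurable_const.mul (hNm.inner hφm)) (C := 2 * |cst| * (G * M))
      fun σ hσ => ?_
    rw [abs_mul, abs_mul, abs_two]
    exact mul_le_mul_of_nonneg_left ((abs_real_inner_le_norm _ _).trans
      (mul_le_mul (hNb σ hσ) (hbdd σ hσ) (norm_nonneg _) hG0)) (by positivity)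
  have hVS : IntegrableOn (fun σ => (1 + w' σ) * ‖φ σ‖ ^ 2) (Icc a b) := by
    refine integrableOn_Icc_of_bounded (((continuous_const.add hw'c).aestronglyMeasurable).mul ((hφm.norm).pow 2))
      (C := (1 + W) * M ^ 2) fun σ hσ => ?_
    rw [abs_mul, abs_pow, abs_norm]
    have hw1 : |1 + w' σ| ≤ 1 + W := (abs_add_le _ _).trans (by
      rw [abs_one]; have := hW σ hσ; rw [Real.norm_eq_abs] at this; linarith)
    exact mul_le_mul hw1 (pow_le_pow_left₀ (norm_nonneg _) (hbdd σ hσ) 2) (by positivity)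
      (by linarith [abs_nonneg (1 + w' σ)])
  have hsqS : IntegrableOn (fun σ => ‖φ σ‖ ^ 2) (Icc a b) := by
    refine integrableOn_Icc_of_bounded ((hφm.norm).pow 2) (C := M ^ 2) fun σ hσ => ?_
    rw [abs_pow, abs_norm]
    exact pow_le_pow_left₀ (norm_nonneg _) (hbdd σ hσ) 2
  have hqS : IntegrableOn q (Icc a b) := hNS.sub hVS
  -- hence `p` (which agrees with `q` off the null set `{c}`) is integrable on the ball
  have hae : q =ᵐ[volume.restrict (Icc a b)] p := by
    have hne : ∀ᵐ σ ∂(volume.restrict (Icc a b)), σ ∈ ({c} : Set ℝ)ᶜ :=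
      ae_restrict_of_ae (compl_mem_ae_iff.2 (Real.volume_singleton (a := c)))
    filter_upwards [hne, ae_restrict_mem measurableSet_Icc] with σ hσc hσ
    exact (hpq σ hσ hσc).symm
  have hpS : IntegrableOn p (Icc a b) := hqS.congr hae
  -- FTC on the two closed half-balls
  have hPderiv : ∀ σ ∈ Icc a b, σ ≠ c → HasDerivAt (fun x => w x * ‖φ x‖ ^ 2) (p σ) σ :=
    fun σ hσ hσc => hasDerivAt_flux (hw σ) (hφ σ hσ hσc)
  have hpac : IntervalIntegrable p volume a c := intervalIntegrable_of_integrableOn_Icc hpS le_rfl hac.le hcb.le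
  have hpcb : IntervalIntegrable p volume c b := intervalIntegrable_of_integrableOn_Icc hpS hac.le hcb.le le_rfl
  have hleft : ∫ σ in a..c, p σ = 0 - w a * ‖φ a‖ ^ 2 := by
    have h := integral_eq_sub_of_hasDerivAt_of_le hac.le
      (continuousOn_flux hwc hwc0 (Icc_subset_Icc le_rfl hcb.le) hφ hbdd)
      (fun σ hσ => hPderiv σ ⟨hσ.1.le, hσ.2.le.trans hcb.le⟩ hσ.2.ne) hpac
    rw [h, hwc0, zero_mul]
  have hright : ∫ σ in c..b, p σ = w b * ‖φ b‖ ^ 2 - 0 := by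
    have h := integral_eq_sub_of_hasDerivAt_of_le hcb.le
      (continuousOn_flux hwc hwc0 (Icc_subset_Icc hac.le le_rfl) hφ hbdd)
      (fun σ hσ => hPderiv σ ⟨hac.le.trans hσ.1.le, hσ.2.le⟩ hσ.1.ne') hpcb
    rw [h, hwc0, zero_mul]
  have hflux_nonneg : 0 ≤ ∫ σ in a..b, p σ := by
    rw [← integral_add_adjacent_intervals hpac hpcb, hleft, hright]
    have h1 : 0 ≤ w b * ‖φ b‖ ^ 2 := mul_nonneg hwb (sq_nonneg _)
    have h2 : w a * ‖φ a‖ ^ 2 ≤ 0 := mul_nonpos_of_nonpos_of_nonneg hwa (sq_nonneg _)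
    linarith
  -- the same integral computed through `q`
  have hpq_int : ∫ σ in a..b, p σ = ∫ σ in a..b, q σ := by
    refine intervalIntegral.integral_congr_ae ?_
    have hne : ∀ᵐ σ ∂(volume : Measure ℝ), σ ∈ ({c} : Set ℝ)ᶜ :=
      compl_mem_ae_iff.2 (Real.volume_singleton (a := c))
    filter_upwards [hne] with σ hσc hσ
    rw [uIoc_of_le hab] at hσ
    exact hpq σ ⟨hσ.1.le, hσ.2⟩ hσc
  have hNI : IntervalIntegrable (fun σ => 2 * cst * ⟪N σ, φ σ⟫) volume a b :=
    intervalIntegrable_of_integrableOn_Icc hNS le_rfl hab le_rfl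
  have hVI : IntervalIntegrable (fun σ => (1 + w' σ) * ‖φ σ‖ ^ 2) volume a b :=
    intervalIntegrable_of_integrableOn_Icc hVS le_rfl hab le_rfl
  have hsqI : IntervalIntegrable (fun σ => ‖φ σ‖ ^ 2) volume a b :=
    intervalIntegrable_of_integrableOn_Icc hsqS le_rfl hab le_rfl
  -- the nonlocal pairing vanishes
  have hN0 : ∫ σ in a..b, 2 * cst * ⟪N σ, φ σ⟫ = 0 := by
    rw [intervalIntegral.integral_const_mul, integral_of_le hab, ← integral_Icc_eq_integral_Ioc,
      setIntegral_inner_nonlocal_eq_zero_of_bounded hab hk hkev hφm hbdd d, mul_zero]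
  -- conclusion: `∫ (1 + w')‖φ‖² ≤ 0`, hence `∫ ‖φ‖² ≤ 0`
  have hq_split : ∫ σ in a..b, q σ = (∫ σ in a..b, 2 * cst * ⟪N σ, φ σ⟫) - ∫ σ in a..b, (1 + w' σ) * ‖φ σ‖ ^ 2 := by
    simp only [hq]
    exact intervalIntegral.integral_sub hNI hVI
  have hV_le : ∫ σ in a..b, (1 + w' σ) * ‖φ σ‖ ^ 2 ≤ 0 := by
    have := hflux_nonneg
    rw [hpq_int, hq_split, hN0] at this
    linarith
  have hsq_le : ∫ σ in a..b, ‖φ σ‖ ^ 2 ≤ 0 := by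
    have hmono : ∫ σ in a..b, (2 * ε) * ‖φ σ‖ ^ 2 ≤ ∫ σ in a..b, (1 + w' σ) * ‖φ σ‖ ^ 2 :=
      intervalIntegral.integral_mono_on hab (hsqI.const_mul _) hVI fun σ hσ =>
        mul_le_mul_of_nonneg_right (by linarith [hgrowth σ hσ]) (sq_nonneg _)
    rw [intervalIntegral.integral_const_mul] at hmono
    by_contra hlt
    have : 0 < 2 * ε * ∫ σ in a..b, ‖φ σ‖ ^ 2 := mul_pos (by linarith) (not_le.mp hlt)
    linarith
  -- `φ = 0` on each punctured half by continuity
  intro σ₀ hσ₀ hσ₀c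
  have hcontS : ∀ {a' b' : ℝ}, Icc a' b' ⊆ Icc a b → c ∉ Icc a' b' → ContinuousOn φ (Icc a' b') :=
    fun hsub hc σ hσ => (hφ σ (hsub hσ) (fun h => hc (h ▸ hσ))).continuousAt.continuousWithinAt
  rcases lt_or_gt_of_ne hσ₀c with hlt | hgt
  · -- left half: `[a, (σ₀ + c)/2]`
    have h1 : σ₀ < (σ₀ + c) / 2 := by linarith
    have h2 : (σ₀ + c) / 2 < c := by linarith
    exact eq_zero_of_integral_norm_sq_le le_rfl (lt_of_le_of_lt hσ₀.1 h1) (h2.le.trans hcb.le)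
      (hcontS (Icc_subset_Icc le_rfl (h2.le.trans hcb.le)) fun hc => (not_le.mpr h2) hc.2) hsqI hsq_le
      ⟨hσ₀.1, h1.le⟩
  · -- right half: `[(c + σ₀)/2, b]`
    have h1 : c < (c + σ₀) / 2 := by linarith
    have h2 : (c + σ₀) / 2 < σ₀ := by linarith
    exact eq_zero_of_integral_norm_sq_le (hac.le.trans h1.le) (lt_of_lt_of_le h2 hσ₀.2) le_rfl
      (hcontS (Icc_subset_Icc (hac.le.trans h1.le) le_rfl) fun hc => (not_le.mpr h1) hc.1) hsqI hsq_le
      ⟨h2.le, hσ₀.2⟩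

/-! ## §4 The `L¹` version (census item (R-m1) verbatim): no INTEGRABLE punctured annihilator -/

/-- The global homogeneous equation, read on the punctured ball as the SOURCED local equation of `…Clause13RAdjointWaistSourced`
with source `g = cst • N` (the nonlocal term moved to the right-hand side). [folklore] -/
theorem local_form_of_eq {cst α : ℝ} {m w w' : ℝ → ℝ} {φ φ' : ℝ → EuclideanSpace ℝ (Fin 3)} {d e : EuclideanSpace ℝ (Fin 3)}
    {N : ℝ → EuclideanSpace ℝ (Fin 3)} {s : ℝ}
    (h : cst • (m s • cross (φ s) d - N s) + (1 / 2 : ℝ) • φ s + α • cross e (φ s) + w' s • φ s + w s • φ' s = 0) :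
    w s • φ' s + (1 / 2 : ℝ) • φ s + w' s • φ s + α • cross e (φ s) + (cst * m s) • cross (φ s) d = cst • N s := by
  rw [smul_sub, smul_smul] at h
  have : w s • φ' s + (1 / 2 : ℝ) • φ s + w' s • φ s + α • cross e (φ s) + (cst * m s) • cross (φ s) d
      = ((cst * m s) • cross (φ s) d - cst • N s + (1 / 2 : ℝ) • φ s + α • cross e (φ s) + w' s • φ s + w s • φ' s)
        + cst • N s := by abel
  rw [this, h, zero_add]

/-- Sup bound for the nonlocal term of an INTEGRABLE weight: `‖N σ‖ ≤ ∫_S K‖d‖‖φ‖` on `S`. [folklore] -/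
theorem norm_nonlocal_le_of_integrableOn {a b K : ℝ} {k : ℝ → ℝ}
    (hK : ∀ σ ∈ Icc a b, ∀ τ ∈ Icc a b, |k (τ - σ)| ≤ K) (hK0 : 0 ≤ K)
    {φ : ℝ → EuclideanSpace ℝ (Fin 3)} (hint : IntegrableOn φ (Icc a b)) (d : EuclideanSpace ℝ (Fin 3))
    {σ : ℝ} (hσ : σ ∈ Icc a b) :
    ‖∫ τ in Icc a b, k (τ - σ) • cross (φ τ) d‖ ≤ ∫ τ in Icc a b, K * ‖d‖ * ‖φ τ‖ := by
  have hcx : ∀ x : EuclideanSpace ℝ (Fin 3), ‖cross x d‖ ≤ ‖x‖ * ‖d‖ := fun x => by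
    rw [norm_cross]; nlinarith [Real.sin_le_one (InnerProductGeometry.angle x d), mul_nonneg (norm_nonneg x) (norm_nonneg d)]
  refine norm_integral_le_of_norm_le ((hint.norm.const_mul (K * ‖d‖))) ?_
  filter_upwards [ae_restrict_mem measurableSet_Icc] with τ hτ
  rw [norm_smul, Real.norm_eq_abs]
  calc |k (τ - σ)| * ‖cross (φ τ) d‖ ≤ K * (‖φ τ‖ * ‖d‖) := mul_le_mul (hK σ hσ τ hτ) (hcx _) (norm_nonneg _) hK0
    _ = K * ‖d‖ * ‖φ τ‖ := by ring

/-- **NO INTEGRABLE ANNIHILATING DENSITY ACROSS THE WAIST (model adjoint equation, punctured ball) — census item (R-m1).**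
As in `model_adjoint_no_bounded_punctured_annihilator`, but with «bounded on `S`» replaced by «INTEGRABLE on `S`», under the two-sided
linear opening of the slip at the waist station, `κ₁|s − c| ≤ |w(s)| ≤ κ₂|s − c|` on `S` (`κ₁ > 0`) with `w ≤ 0` left of `c` and
`w ≥ 0` right of `c` (automatic for a `C¹` slip whose only zero in `S` is `c`, with `w′(c) > 0`).  By the landed local classification
(`…Clause13RAdjointWaistIntegrable.wnorm_le_of_integrableOn_right/_left`, p831266) an integrable solution on each punctured half-ball is
waist-regular, `|w(σ)|‖φ(σ)‖ ≤ G|σ − c|` with `G = |cst|·sup‖N‖`, hence bounded by `G/κ₁`; then the bounded theorem applies.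
Consequence: at model level the density part of ANY annihilating measure (a priori only `L¹`) of the homogeneous adjoint equation vanishes
off the waist — no interior density and no singular waist branch enlarges the edge cokernel. [folklore] -/
theorem model_adjoint_no_integrable_punctured_annihilator {a b c cst α ε κ₁ κ₂ : ℝ} (hac : a < c) (hcb : c < b) (hε : 0 < ε)
    (hκ₁ : 0 < κ₁) {k m w w' : ℝ → ℝ} {φ φ' : ℝ → EuclideanSpace ℝ (Fin 3)} {d e : EuclideanSpace ℝ (Fin 3)}
    (hk : Continuous k) (hkev : ∀ s, k (-s) = k s)
    (hw : ∀ σ, HasDerivAt w (w' σ) σ) (hw'c : Continuous w') (hgrowth : ∀ σ ∈ Icc a b, -1 + 2 * ε ≤ w' σ)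
    (hwlow : ∀ s ∈ Icc a b, κ₁ * |s - c| ≤ |w s|) (hwup : ∀ s ∈ Icc a b, |w s| ≤ κ₂ * |s - c|)
    (hwneg : ∀ s ∈ Ico a c, w s ≤ 0) (hwpos : ∀ s ∈ Ioc c b, 0 ≤ w s)
    (hφ : ∀ σ ∈ Icc a b, σ ≠ c → HasDerivAt φ (φ' σ) σ) (hint : IntegrableOn φ (Icc a b))
    (heq : ∀ σ ∈ Icc a b, σ ≠ c →
      cst • (m σ • cross (φ σ) d - ∫ τ in Icc a b, k (τ - σ) • cross (φ τ) d)
        + (1 / 2 : ℝ) • φ σ + α • cross e (φ σ) + w' σ • φ σ + w σ • φ' σ = 0) :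
    ∀ σ ∈ Icc a b, σ ≠ c → φ σ = 0 := by
  have hab : a ≤ b := (hac.trans hcb).le
  have hcS : c ∈ Icc a b := ⟨hac.le, hcb.le⟩
  have hwc0 : w c = 0 := by
    have h := hwup c hcS
    rw [sub_self, abs_zero, mul_zero] at h
    exact abs_eq_zero.mp (le_antisymm h (abs_nonneg _))
  -- the source `g = cst • N` is bounded on the ball
  set N : ℝ → EuclideanSpace ℝ (Fin 3) := fun σ => ∫ τ in Icc a b, k (τ - σ) • cross (φ τ) d with hN
  obtain ⟨K, hK0, hK⟩ := kernel_bound_on_ball (a := a) (b := b) hk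
  set G : ℝ := |cst| * ∫ τ in Icc a b, K * ‖d‖ * ‖φ τ‖ with hG
  have hgS : ∀ s ∈ Icc a b, ‖cst • N s‖ ≤ G := fun s hs => by
    rw [norm_smul, Real.norm_eq_abs]
    exact mul_le_mul_of_nonneg_left (norm_nonlocal_le_of_integrableOn hK hK0 hint d hs) (abs_nonneg _)
  have hG0 : 0 ≤ G := (norm_nonneg _).trans (hgS a ⟨le_rfl, hab⟩)
  have hloc : ∀ s ∈ Icc a b, s ≠ c →
      w s • φ' s + (1 / 2 : ℝ) • φ s + w' s • φ s + α • cross e (φ s) + (cst * m s) • cross (φ s) d = cst • N s :=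
    fun s hs hsc => local_form_of_eq (heq s hs hsc)
  -- right half-ball `(c, b]`: waist-regular, hence bounded by `G/κ₁`
  have hR : ∀ σ ∈ Ioc c b, ‖φ σ‖ ≤ G / κ₁ := by
    intro σ hσ
    have hsub : ∀ s ∈ Ioc c b, s ∈ Icc a b := fun s hs => ⟨hac.le.trans hs.1.le, hs.2⟩
    have hwn := wnorm_le_of_integrableOn_right (σ₁ := b) (g := fun s => cst • N s) (G := G) (κ₂ := κ₂)
      (fun s hs => hw s) (fun s hs => hφ s (hsub s hs) hs.1.ne') hwpos
      (fun s hs => by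
        have h := hwup s (hsub s hs)
        rw [abs_of_pos (sub_pos.2 hs.1)] at h
        exact (le_abs_self _).trans h)
      (fun s hs => hgS s (hsub s hs)) (fun s hs => hloc s (hsub s hs) hs.1.ne')
      (hint.mono_set fun s hs => hsub s hs) hσ
    have hσc : 0 < σ - c := sub_pos.2 hσ.1
    have hwl : κ₁ * (σ - c) ≤ w σ := by
      have h := hwlow σ (hsub σ hσ)
      rwa [abs_of_pos hσc, abs_of_nonneg (hwpos σ hσ)] at h
    rw [le_div_iff₀ hκ₁]
    have h1 : κ₁ * (σ - c) * ‖φ σ‖ ≤ G * (σ - c) :=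
      (mul_le_mul_of_nonneg_right hwl (norm_nonneg _)).trans hwn
    nlinarith [h1, hσc, norm_nonneg (φ σ)]
  -- left half-ball `[a, c)`: the same
  have hL : ∀ σ ∈ Ico a c, ‖φ σ‖ ≤ G / κ₁ := by
    intro σ hσ
    have hsub : ∀ s ∈ Ico a c, s ∈ Icc a b := fun s hs => ⟨hs.1, hs.2.le.trans hcb.le⟩
    have hwn := wnorm_le_of_integrableOn_left (σ₁ := a) (g := fun s => cst • N s) (G := G) (κ₂ := κ₂)
      (fun s hs => hw s) (fun s hs => hφ s (hsub s hs) hs.2.ne) hwneg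
      (fun s hs => by
        have h := hwup s (hsub s hs)
        rwa [abs_sub_comm, abs_of_pos (sub_pos.2 hs.2)] at h)
      (fun s hs => hgS s (hsub s hs)) (fun s hs => hloc s (hsub s hs) hs.2.ne)
      (hint.mono_set fun s hs => hsub s hs) hσ
    have hσc : 0 < c - σ := sub_pos.2 hσ.2
    have hwl : κ₁ * (c - σ) ≤ |w σ| := by
      have h := hwlow σ (hsub σ hσ)
      rwa [abs_sub_comm, abs_of_pos hσc] at h
    rw [le_div_iff₀ hκ₁]
    have h1 : κ₁ * (c - σ) * ‖φ σ‖ ≤ G * (c - σ) :=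
      (mul_le_mul_of_nonneg_right hwl (norm_nonneg _)).trans hwn
    nlinarith [h1, hσc, norm_nonneg (φ σ)]
  -- a bound on the whole ball (the value at `c` is irrelevant but finite)
  have hbdd : ∀ σ ∈ Icc a b, ‖φ σ‖ ≤ max (G / κ₁) ‖φ c‖ := by
    intro σ hσ
    rcases lt_trichotomy σ c with hlt | heq' | hgt
    · exact (hL σ ⟨hσ.1, hlt⟩).trans (le_max_left _ _)
    · rw [heq']; exact le_max_right _ _
    · exact (hR σ ⟨hgt, hσ.2⟩).trans (le_max_left _ _)
  exact model_adjoint_no_bounded_punctured_annihilator hac hcb hε hk hkev hw hw'c hwc0 (hwneg a ⟨le_rfl, hac⟩)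
    (hwpos b ⟨hcb, le_rfl⟩) hgrowth hφ hbdd heq

end Summit.NavierStokesRegularity.NavierStokesRegularity.Theorems.Clause13RAdjointPunctured

end
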